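import Mathlib
import Literature.Probability.LatticeModels.ThermodynamicLimit
import HarnessLib

/-!
# Soft OS-assembly toolkit V: `a`-uniform lattice Riemann-sum bounds

Helper file for stub `stub_assembly` of crux `OSLegsFromFemtoAndGap` (stmt-QuantumFields-9367, line
`dlr-collar-transfer`).  The smeared lattice `n`-point distributions are finite sums `∑ₓ W(x) F(a x)` over the
sites of a torus; their `a`-uniform bounds reduce (after the flat-decay estimate of toolkit IV and the collar bound
`MomentBounds`) to the elementary fact that `∑_{z ∈ ℤ⁴} a⁴ (1 + a‖z‖)⁻ᵖ` is bounded uniformly in `0 < a ≤ 1` for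
`p ≥ 6` (a Riemann sum of the integrable `(1 + |y|)⁻ᵖ`), and its `n`-fold product version.

* `sum_decay_le` — `∑_{z ∈ s} a⁴ (1 + a‖z‖)⁻ᵖ ≤ 81 ∑' m, ((m+1)²)⁻¹` for every finite `s ⊆ ℤ⁴`, `0 < a ≤ 1`,
  `6 ≤ p` (fibre the sum by `⌊a‖z‖⌋₊`; the fibre of `m` lies in a cube of `≤ (3(m+1)/a)⁴` sites);
* `sum_prod_decay_le` — the product version over `n` sites: `∑_{x ∈ (s)ⁿ} ∏ᵢ a⁴ (1 + a‖xᵢ‖)⁻ᵖ ≤ Cⁿ`.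
-/

noncomputable section

open scoped BigOperators
open Finset Literature.Probability.LatticeModels

namespace Summit.QuantumFields.YangMills.Theorems.OSLegsFromFemtoAndGap

/-- The universal constant `81 · ∑ₘ (m+1)⁻²` of the lattice Riemann-sum bound. -/
theorem summable_inv_succ_sq : Summable fun m : ℕ => (((m : ℝ) + 1) ^ 2)⁻¹ := by
  have h := (Real.summable_nat_pow_inv (p := 2)).2 one_lt_two
  simpa [Nat.cast_add, Nat.cast_one] using (summable_nat_add_iff 1).2 h

/-- Sites of sup norm `< (m+1)/a` lie in the cube of half-side `⌊(m+1)/a⌋₊`. [folklore] -/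
theorem mem_piFinset_of_norm_lt {a : ℝ} (ha : 0 < a) {m : ℕ} {z : Site 4}
    (hz : a * ‖z‖ < m + 1) :
    z ∈ Fintype.piFinset fun _ : Fin 4 => Finset.Icc (-(⌊((m : ℝ) + 1) / a⌋₊ : ℤ)) ⌊((m : ℝ) + 1) / a⌋₊ := by
  rw [Fintype.mem_piFinset]
  intro k
  have hzk : ‖z k‖ ≤ ‖z‖ := norm_le_pi_norm z k
  have h1 : (‖z k‖ : ℝ) < (m + 1) / a := by
    rw [lt_div_iff₀ ha]; nlinarith
  have h2 : |z k| ≤ (⌊((m : ℝ) + 1) / a⌋₊ : ℤ) := by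
    have h3 : ((|z k| : ℤ) : ℝ) < (m + 1) / a := by
      rw [Int.cast_abs]; simpa [Int.norm_eq_abs] using h1
    have h4 : (|z k| : ℤ) ≤ ⌊((m : ℝ) + 1) / a⌋ := Int.le_floor.2 h3.le
    have h5 : (⌊((m : ℝ) + 1) / a⌋ : ℤ) = ((⌊((m : ℝ) + 1) / a⌋₊ : ℕ) : ℤ) := by
      rw [Int.natCast_floor_eq_floor]
      positivity
    rw [← h5]; exact h4
  rw [Finset.mem_Icc]
  constructor <;> linarith [abs_le.1 h2 |>.1, abs_le.1 h2 |>.2]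

/-- The cube of half-side `K` has `(2K+1)⁴` sites. [folklore] -/
theorem card_piFinset_Icc (K : ℕ) :
    #(Fintype.piFinset fun _ : Fin 4 => Finset.Icc (-(K : ℤ)) K) = (2 * K + 1) ^ 4 := by
  rw [Fintype.card_piFinset, Finset.prod_const, Finset.card_univ, Fintype.card_fin]
  congr 1
  rw [Int.card_Icc]
  omega

/-- **`a`-uniform lattice Riemann-sum bound.** For `0 < a ≤ 1`, `6 ≤ p` and every finite set of sites of `ℤ⁴`:
`∑_{z ∈ s} a⁴ (1 + a‖z‖)⁻ᵖ ≤ 81 ∑' m, ((m+1)²)⁻¹`. [folklore] -/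
theorem sum_decay_le {a : ℝ} (ha : 0 < a) (ha1 : a ≤ 1) {p : ℕ} (hp : 6 ≤ p) (s : Finset (Site 4)) :
    ∑ z ∈ s, a ^ 4 * ((1 + a * ‖z‖) ^ p)⁻¹ ≤ 81 * ∑' m : ℕ, (((m : ℝ) + 1) ^ 2)⁻¹ := by
  classical
  -- fibre by `μ z = ⌊a ‖z‖⌋₊`
  set μ : Site 4 → ℕ := fun z => ⌊a * ‖z‖⌋₊ with hμ
  have hnn : ∀ z : Site 4, 0 ≤ a * ‖z‖ := fun z => mul_nonneg ha.le (norm_nonneg _)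
  rw [← Finset.sum_fiberwise_of_maps_to (g := μ) (t := s.image μ) (fun z hz => Finset.mem_image_of_mem μ hz)]
  -- bound each fibre
  have hfib : ∀ m ∈ s.image μ, ∑ z ∈ s.filter (fun z => μ z = m), a ^ 4 * ((1 + a * ‖z‖) ^ p)⁻¹ ≤ 81 * (((m : ℝ) + 1) ^ 2)⁻¹ := by
    intro m _
    -- on the fibre the summand is at most `a⁴ (1+m)⁻ᵖ`
    have hterm : ∀ z ∈ s.filter (fun z => μ z = m), a ^ 4 * ((1 + a * ‖z‖) ^ p)⁻¹ ≤ a ^ 4 * (((m : ℝ) + 1) ^ p)⁻¹ := by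
      intro z hz
      rw [Finset.mem_filter] at hz
      have hmz : (m : ℝ) ≤ a * ‖z‖ := by rw [← hz.2]; exact Nat.floor_le (hnn z)
      have hpow : ((m : ℝ) + 1) ^ p ≤ (1 + a * ‖z‖) ^ p := pow_le_pow_left₀ (by positivity) (by linarith) p
      exact mul_le_mul_of_nonneg_left (inv_anti₀ (by positivity) hpow) (by positivity)
    -- the fibre lies in a cube of half-side `⌊(m+1)/a⌋₊`
    have hsub : s.filter (fun z => μ z = m) ⊆
        Fintype.piFinset fun _ : Fin 4 => Finset.Icc (-(⌊((m : ℝ) + 1) / a⌋₊ : ℤ)) ⌊((m : ℝ) + 1) / a⌋₊ := by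
      intro z hz
      rw [Finset.mem_filter] at hz
      refine mem_piFinset_of_norm_lt ha ?_
      have h' : a * ‖z‖ < (μ z : ℝ) + 1 := Nat.lt_floor_add_one (a * ‖z‖)
      rw [hz.2] at h'
      exact h'
    have hcard : (#(s.filter fun z => μ z = m) : ℝ) ≤ (3 * ((m : ℝ) + 1) / a) ^ 4 := by
      have h1 := Finset.card_le_card hsub
      rw [card_piFinset_Icc] at h1
      have h2 : ((2 * ⌊((m : ℝ) + 1) / a⌋₊ + 1 : ℕ) : ℝ) ≤ 3 * ((m : ℝ) + 1) / a := by
        have hfl : (⌊((m : ℝ) + 1) / a⌋₊ : ℝ) ≤ ((m : ℝ) + 1) / a := Nat.floor_le (by positivity)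
        have h1a : (1 : ℝ) ≤ ((m : ℝ) + 1) / a := by
          rw [le_div_iff₀ ha]; nlinarith
        have h3 : 3 * ((m : ℝ) + 1) / a = 3 * (((m : ℝ) + 1) / a) := by ring
        rw [h3]; push_cast; linarith
      calc (#(s.filter fun z => μ z = m) : ℝ) ≤ ((2 * ⌊((m : ℝ) + 1) / a⌋₊ + 1) ^ 4 : ℕ) := by exact_mod_cast h1
        _ = (((2 * ⌊((m : ℝ) + 1) / a⌋₊ + 1 : ℕ) : ℝ)) ^ 4 := by push_cast; ring
        _ ≤ (3 * ((m : ℝ) + 1) / a) ^ 4 := by gcongr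
    calc ∑ z ∈ s.filter (fun z => μ z = m), a ^ 4 * ((1 + a * ‖z‖) ^ p)⁻¹
        ≤ ∑ z ∈ s.filter (fun z => μ z = m), a ^ 4 * (((m : ℝ) + 1) ^ p)⁻¹ := Finset.sum_le_sum hterm
      _ = #(s.filter fun z => μ z = m) * (a ^ 4 * (((m : ℝ) + 1) ^ p)⁻¹) := by
          rw [Finset.sum_const, nsmul_eq_mul]
      _ ≤ (3 * ((m : ℝ) + 1) / a) ^ 4 * (a ^ 4 * (((m : ℝ) + 1) ^ p)⁻¹) := by gcongr
      _ = 81 * (((m : ℝ) + 1) ^ 4 * (((m : ℝ) + 1) ^ p)⁻¹) := by field_simp; ring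
      _ ≤ 81 * (((m : ℝ) + 1) ^ 2)⁻¹ := by
          gcongr
          -- `(m+1)^4 / (m+1)^p ≤ 1/(m+1)^2` for `p ≥ 6`
          have hm1 : (1 : ℝ) ≤ (m : ℝ) + 1 := by linarith [(Nat.cast_nonneg m : (0 : ℝ) ≤ m)]
          obtain ⟨q, rfl⟩ : ∃ q, p = q + 4 := ⟨p - 4, by omega⟩
          have key : ((m : ℝ) + 1) ^ 4 * (((m : ℝ) + 1) ^ (q + 4))⁻¹ = (((m : ℝ) + 1) ^ q)⁻¹ := by
            rw [pow_add]
            field_simp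
          rw [key]
          exact inv_anti₀ (by positivity) (pow_le_pow_right₀ hm1 (by omega))
  calc ∑ m ∈ s.image μ, ∑ z ∈ s.filter (fun z => μ z = m), a ^ 4 * ((1 + a * ‖z‖) ^ p)⁻¹
      ≤ ∑ m ∈ s.image μ, 81 * (((m : ℝ) + 1) ^ 2)⁻¹ := Finset.sum_le_sum hfib
    _ = 81 * ∑ m ∈ s.image μ, (((m : ℝ) + 1) ^ 2)⁻¹ := by rw [Finset.mul_sum]
    _ ≤ 81 * ∑' m : ℕ, (((m : ℝ) + 1) ^ 2)⁻¹ := by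
        gcongr
        exact Summable.sum_le_tsum _ (fun m _ => by positivity) summable_inv_succ_sq

/-- **Product version.** `∑_{x ∈ sⁿ} ∏ᵢ a⁴ (1 + a‖xᵢ‖)⁻ᵖ ≤ (81 ∑' m, (m+1)⁻²)ⁿ` for `0 < a ≤ 1`, `6 ≤ p`. [folklore] -/
theorem sum_prod_decay_le {a : ℝ} (ha : 0 < a) (ha1 : a ≤ 1) {p : ℕ} (hp : 6 ≤ p) (s : Finset (Site 4)) (n : ℕ) :
    ∑ x ∈ Fintype.piFinset (fun _ : Fin n => s), ∏ i, (a ^ 4 * ((1 + a * ‖x i‖) ^ p)⁻¹) ≤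
      (81 * ∑' m : ℕ, (((m : ℝ) + 1) ^ 2)⁻¹) ^ n := by
  rw [← Finset.prod_univ_sum (fun _ : Fin n => s) (fun _ z => a ^ 4 * ((1 + a * ‖z‖) ^ p)⁻¹)]
  rw [Finset.prod_const, Finset.card_univ, Fintype.card_fin]
  exact pow_le_pow_left₀ (Finset.sum_nonneg fun z _ => by positivity) (sum_decay_le ha ha1 hp s) n

end Summit.QuantumFields.YangMills.Theorems.OSLegsFromFemtoAndGap

end
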